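/-
Origin: expansion seat `planner-pub-hodgecm-pv09-g6-0`, handover #1 2026-08-18T11:20:00Z (`HOME/pub-hodgecm-pv09-g6/lean/Pv09g6/RestrictedTensor.lean`, md5 9ca5fcf0, 684 lines);
landed by the gen-8 packager in gate run 29 as `HodgeCM/PerL34/RestrictedTensor.lean` (verbatim).
-/
/-
Copyright: HodgeCM publication cell (pub-hodgecm), seam S3 (𝓕-side / genuine idelic torus end; the
representation-side INPUT of `GenuineThetaInput`).  Prover seat pub-hodgecm-pv09-g6 (DAG-node
prover #09, generation 6), file #1 (HANDOVER #1); intended final place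
`HodgeCM/PerL34/RestrictedTensor.lean`.  Imports: Mathlib + the LANDED `HodgeCM.PerL34.PureTensorCoeff`
only (no WIP import, nothing to rewrite).  Complete proofs, no new axioms, nothing cited.
Released under the package licence.

# The restricted (incomplete) Hilbert tensor product `⊗′_v (H_v, e_v)` and the restricted-product
# representation `⊗′_v ρ_v` — the object that `PureTensorCoeff` / `GenuineThetaInput` POSIT

Pure functional analysis: NO statement of PerL / QW8 / the 2001 programme is cited or used.

## What is constructed (kernel-checked, Mathlib only + the by-name definitions `localCoeff`,
## `extendOne`, `RestrictedProduct.boxSubgroup` of this package)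

For an index type `ι`, complex inner-product spaces `H i` and a family of UNIT vectors
`𝓔.e i ∈ H i` (`UnitFamily`):

* `RVec 𝓔` — restricted families `x = (x_i)`, `x_i = e_i` for all but finitely many `i`;
* the kernel `kfun 𝓔 x y = ∏ᶠ i, ⟪x i, y i⟫` is positive semidefinite (`kfun_sum_nonneg`: finite
  Hadamard products of Gram kernels, Schur's product theorem `Matrix.PosSemidef.hadamard`);
* `Space 𝓔` — the completion of the GNS / Moore pre-Hilbert space of that kernel (von Neumann's
  incomplete tensor product along `e`): a complete complex inner-product space, with pure tensors
  `tp 𝓔 x`, `⟪tp x, tp y⟫ = ∏ᶠ i, ⟪x i, y i⟫`, `‖tp x‖ = ∏ᶠ i, ‖x i‖`, total in `Space 𝓔`;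
* `slot 𝓔 x hx i : H i →ₗᵢ[ℂ] Space 𝓔`, `v ↦ ⊗ (x with x_i := v)` for a family of unit vectors `x`;
* for groups `G i`, subgroups `B i` and unitary representations `ρ i : G i →* (H i ≃ₗᵢ[ℂ] H i)`
  such that `B i` fixes `e i` for all but finitely many `i`: the representation
  `rep : Πʳ i, [G i, B i] →* (Space 𝓔 ≃ₗᵢ[ℂ] Space 𝓔)`, `rep g (tp x) = tp (i ↦ ρ i (g i) (x i))`;
* the S3-headline-shaped identities for `φ := tp φ•` (all `‖φ• i‖ = 1`): `‖φ‖ = 1`, box-subgroup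
  invariance, `localCoeff B rep φ i g = ⟪φ• i, ρ i g (φ• i)⟫`, the product formula over
  `extendOne B S`, the slot intertwiners, the scalar (`hiso`-shaped) action, and strong continuity
  of `g ↦ rep (ι_i g) v` from local strong continuity.
-/
import Mathlib.Analysis.InnerProductSpace.Completion
import Mathlib.Analysis.Matrix.Order
import Mathlib.Topology.Algebra.LinearMapCompletion
import Mathlib.Topology.MetricSpace.Completion
import Mathlib.Topology.UniformSpace.UniformApproximation
import Mathlib.Algebra.BigOperators.Finprod
import Summits.HodgeConjecture.HodgeCM.PerL34.PureTensorCoeff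

set_option autoImplicit false

noncomputable section

open Function Set Filter HodgeCM.PerL34.NoSmallSubgroups
open scoped InnerProductSpace ComplexConjugate RestrictedProduct

namespace HodgeCM.PerL34.RestrictedTensor

universe u v

variable {ι : Type u} {H : ι → Type v} [∀ i, NormedAddCommGroup (H i)]
  [∀ i, InnerProductSpace ℂ (H i)]

/-! ## §1 Restricted families and the product kernel -/

/-- A reference family of UNIT vectors `e i ∈ H i` (the `φ⁰_v` along which the restricted tensor
product is taken). -/
structure UnitFamily (H : ι → Type v) [∀ i, NormedAddCommGroup (H i)]
    [∀ i, InnerProductSpace ℂ (H i)] where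
  /-- the reference vectors -/
  e : ∀ i, H i
  norm_e : ∀ i, ‖e i‖ = 1

variable (𝓔 : UnitFamily H)

/-- Restricted families: `x i = e i` for all but finitely many `i`. -/
structure RVec where
  /-- the components -/
  val : ∀ i, H i
  eventually_eq : ∀ᶠ i in cofinite, val i = 𝓔.e i

namespace RVec

/-- (Ported verbatim from the HodgeCMPerL package; no docstring in the source.) -/
instance : CoeFun (RVec 𝓔) (fun _ => ∀ i, H i) := ⟨RVec.val⟩

variable {𝓔}

/-- (Ported verbatim from the HodgeCMPerL package; no docstring in the source.) -/
@[ext] theorem ext {x y : RVec 𝓔} (h : ∀ i, x i = y i) : x = y := by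
  cases x; cases y; congr; exact funext h

/-- (Ported verbatim from the HodgeCMPerL package; no docstring in the source.) -/
theorem finite_ne (x : RVec 𝓔) : Set.Finite {i | x i ≠ 𝓔.e i} := by
  simpa [Filter.eventually_cofinite] using x.eventually_eq

variable (𝓔) in
/-- The reference family itself (the "vacuum" `⊗ e_i`). -/
def vac : RVec 𝓔 := ⟨𝓔.e, Eventually.of_forall fun _ => rfl⟩

/-- (Ported verbatim from the HodgeCMPerL package; no docstring in the source.) -/
@[simp] theorem vac_apply (i : ι) : vac 𝓔 i = 𝓔.e i := rfl

/-- Apply a family of maps fixing `e i` for almost all `i`. -/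
def map (u : ∀ i, H i → H i) (hu : ∀ᶠ i in cofinite, u i (𝓔.e i) = 𝓔.e i) (x : RVec 𝓔) :
    RVec 𝓔 :=
  ⟨fun i => u i (x i), (x.eventually_eq.and hu).mono fun i hi => by rw [hi.1, hi.2]⟩

/-- (Ported verbatim from the HodgeCMPerL package; no docstring in the source.) -/
@[simp] theorem map_apply (u : ∀ i, H i → H i) (hu : ∀ᶠ i in cofinite, u i (𝓔.e i) = 𝓔.e i)
    (x : RVec 𝓔) (i : ι) : map u hu x i = u i (x i) := rfl

section update

variable [DecidableEq ι]

/-- Change one component. -/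
def update (x : RVec 𝓔) (i : ι) (v : H i) : RVec 𝓔 :=
  ⟨Function.update x i v, (x.eventually_eq.and (Set.finite_singleton i).compl_mem_cofinite).mono
    fun j hj => by
      have hji : j ≠ i := fun h => hj.2 (h ▸ rfl)
      rw [Function.update_of_ne hji, hj.1]⟩

/-- (Ported verbatim from the HodgeCMPerL package; no docstring in the source.) -/
@[simp] theorem update_apply_same (x : RVec 𝓔) (i : ι) (v : H i) : x.update i v i = v := by
  simp [update]

/-- (Ported verbatim from the HodgeCMPerL package; no docstring in the source.) -/
theorem update_apply_of_ne (x : RVec 𝓔) {i j : ι} (h : j ≠ i) (v : H i) :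
    x.update i v j = x j := by
  simp [update, Function.update_of_ne h]

/-- (Ported verbatim from the HodgeCMPerL package; no docstring in the source.) -/
@[simp] theorem update_eq_self (x : RVec 𝓔) (i : ι) : x.update i (x i) = x := by
  ext j; by_cases h : j = i
  · subst h; simp
  · rw [update_apply_of_ne _ h]

end update

end RVec

open RVec

/-- (Ported verbatim from the HodgeCMPerL package; no docstring in the source.) -/
theorem inner_e_e (i : ι) : ⟪𝓔.e i, 𝓔.e i⟫_ℂ = 1 := by
  rw [inner_self_eq_norm_sq_to_K, 𝓔.norm_e i]; simp

variable {𝓔}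

/-- The product kernel `K(x, y) = ∏_i ⟪x i, y i⟫` (a finite product: almost all factors are
`⟪e i, e i⟫ = 1`). -/
def kfun (x y : RVec 𝓔) : ℂ := ∏ᶠ i, ⟪x i, y i⟫_ℂ

/-- (Ported verbatim from the HodgeCMPerL package; no docstring in the source.) -/
theorem mulSupport_inner_subset (x y : RVec 𝓔) :
    mulSupport (fun i => ⟪x i, y i⟫_ℂ) ⊆ {i | x i ≠ 𝓔.e i} ∪ {i | y i ≠ 𝓔.e i} := by
  intro i hi
  by_contra h
  simp only [Set.mem_union, Set.mem_setOf_eq, not_or, not_not] at h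
  exact hi (by simp only [h.1, h.2, inner_e_e])

/-- (Ported verbatim from the HodgeCMPerL package; no docstring in the source.) -/
theorem hasFiniteMulSupport_inner (x y : RVec 𝓔) :
    HasFiniteMulSupport (fun i => ⟪x i, y i⟫_ℂ) :=
  ((x.finite_ne).union y.finite_ne).subset (mulSupport_inner_subset x y)

/-- (Ported verbatim from the HodgeCMPerL package; no docstring in the source.) -/
theorem kfun_eq_prod {x y : RVec 𝓔} {T : Finset ι} (hx : {i | x i ≠ 𝓔.e i} ⊆ ↑T)
    (hy : {i | y i ≠ 𝓔.e i} ⊆ ↑T) : kfun x y = ∏ i ∈ T, ⟪x i, y i⟫_ℂ :=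
  finprod_eq_prod_of_mulSupport_subset _ fun _ hi =>
    (mulSupport_inner_subset x y hi).elim (fun h => hx h) (fun h => hy h)

/-- (Ported verbatim from the HodgeCMPerL package; no docstring in the source.) -/
theorem conj_kfun (x y : RVec 𝓔) : conj (kfun x y) = kfun y x := by
  unfold kfun
  rw [map_finprod _ (hasFiniteMulSupport_inner x y)]
  exact finprod_congr fun i => inner_conj_symm _ _

/-- (Ported verbatim from the HodgeCMPerL package; no docstring in the source.) -/
@[simp] theorem kfun_vac_vac : kfun (vac 𝓔) (vac 𝓔) = 1 :=
  finprod_eq_one_of_forall_eq_one fun i => inner_e_e 𝓔 i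

/-! ### Positive semidefiniteness (Schur product theorem on the truncated kernels) -/

section psd

open scoped ComplexOrder

/-- Gram kernels are positive semidefinite (any index type; Mathlib's `posSemidef_gram` wants a
finite one). -/
theorem posSemidef_of_inner {X E : Type*} [SeminormedAddCommGroup E] [InnerProductSpace ℂ E]
    (v : X → E) : (Matrix.of fun x y : X => ⟪v x, v y⟫_ℂ).PosSemidef := by
  classical
  refine ⟨?_, fun c => ?_⟩
  · ext x y
    simp [Matrix.conjTranspose_apply]
  · have h : (c.sum fun x a => c.sum fun y b => star a * (Matrix.of fun x y : X => ⟪v x, v y⟫_ℂ) x y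
        * b) = ⟪c.sum fun x a => a • v x, c.sum fun y b => b • v y⟫_ℂ := by
      simp only [Finsupp.sum, sum_inner, inner_sum, inner_smul_left, inner_smul_right,
        Matrix.of_apply, Complex.star_def]
      rw [Finset.sum_comm]
      refine Finset.sum_congr rfl fun y _ => ?_
      rw [Finset.mul_sum]
      refine Finset.sum_congr rfl fun x _ => ?_
      ring
    have h' : ⟪c.sum fun x a => a • v x, c.sum fun y b => b • v y⟫_ℂ =
        ((‖c.sum fun x a => a • v x‖ ^ 2 : ℝ) : ℂ) := by
      rw [inner_self_eq_norm_sq_to_K]; norm_cast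
    rw [h, h']
    exact Complex.zero_le_real.mpr (sq_nonneg _)

/-- The truncated kernels `∏_{i ∈ T} ⟪x i, y i⟫` are positive semidefinite. -/
theorem posSemidef_trunc (T : Finset ι) :
    (Matrix.of fun x y : RVec 𝓔 => ∏ i ∈ T, ⟪x i, y i⟫_ℂ).PosSemidef := by
  classical
  induction T using Finset.induction_on with
  | empty =>
    have h : (Matrix.of fun x y : RVec 𝓔 => ∏ i ∈ (∅ : Finset ι), ⟪x i, y i⟫_ℂ) =
        Matrix.of fun x y : RVec 𝓔 => ⟪(fun _ : RVec 𝓔 => (1 : ℂ)) x, (fun _ => (1 : ℂ)) y⟫_ℂ := by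
      ext x y; simp
    rw [h]; exact posSemidef_of_inner _
  | insert j T hj ih =>
    have h : (Matrix.of fun x y : RVec 𝓔 => ∏ i ∈ insert j T, ⟪x i, y i⟫_ℂ) =
        Matrix.hadamard (Matrix.of fun x y : RVec 𝓔 => ⟪x j, y j⟫_ℂ)
          (Matrix.of fun x y : RVec 𝓔 => ∏ i ∈ T, ⟪x i, y i⟫_ℂ) := by
      ext x y; simp [Finset.prod_insert hj]
    rw [h]; exact (posSemidef_of_inner fun x : RVec 𝓔 => x j).hadamard ih

/-- **The product kernel is positive semidefinite.** -/
theorem kfun_sum_nonneg (c : RVec 𝓔 →₀ ℂ) :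
    0 ≤ c.sum fun x a => c.sum fun y b => conj a * b * kfun x y := by
  classical
  set T : Finset ι := c.support.biUnion fun x => (x.finite_ne).toFinset with hT
  have hsub : ∀ x ∈ c.support, {i | x i ≠ 𝓔.e i} ⊆ ↑T := fun x hx i hi => by
    simp only [hT, Finset.coe_biUnion, Finset.mem_coe, Set.mem_iUnion, Set.Finite.coe_toFinset,
      Set.mem_setOf_eq, exists_prop]
    exact ⟨x, hx, hi⟩
  have key := (posSemidef_trunc (𝓔 := 𝓔) T).2 c
  have h : (c.sum fun x a => c.sum fun y b => conj a * b * kfun x y) = c.sum fun x a =>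
      c.sum fun y b => star a * (Matrix.of fun x y : RVec 𝓔 => ∏ i ∈ T, ⟪x i, y i⟫_ℂ) x y * b := by
    simp only [Finsupp.sum]
    refine Finset.sum_congr rfl fun x hx => Finset.sum_congr rfl fun y hy => ?_
    rw [Matrix.of_apply, kfun_eq_prod (hsub x hx) (hsub y hy), Complex.star_def]; ring
  rw [h]; exact key

end psd

/-! ## §2 The space: completion of the GNS pre-Hilbert space of the kernel -/

variable (𝓔) in
/-- Finitely supported formal combinations of restricted pure tensors. -/
abbrev Pre : Type (max u v) := RVec 𝓔 →₀ ℂ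

/-- (Ported verbatim from the HodgeCMPerL package; no docstring in the source.) -/
instance instCorePre : PreInnerProductSpace.Core ℂ (Pre 𝓔) where
  inner f g := f.sum fun x a => g.sum fun y b => conj a * b * kfun x y
  conj_inner_symm f g := by
    simp only [map_finsuppSum, map_mul, Complex.conj_conj, conj_kfun]
    rw [Finsupp.sum_comm]
    exact Finsupp.sum_congr fun x _ => Finsupp.sum_congr fun y _ => by ring
  add_left _ _ _ := by
    rw [Finsupp.sum_add_index'] <;> simp [← Finsupp.sum_add, add_mul]
  smul_left _ _ _ := by
    rw [Finsupp.sum_smul_index] <;> simp [Finsupp.mul_sum, ← mul_assoc]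
  re_inner_nonneg f := by
    obtain ⟨h1, -⟩ := Complex.le_def.mp (kfun_sum_nonneg f)
    simpa using h1

/-- (Ported verbatim from the HodgeCMPerL package; no docstring in the source.) -/
instance instSeminormedAddCommGroupPre : SeminormedAddCommGroup (Pre 𝓔) :=
  InnerProductSpace.Core.toSeminormedAddCommGroup (𝕜 := ℂ)

/-- (Ported verbatim from the HodgeCMPerL package; no docstring in the source.) -/
instance instInnerProductSpacePre : InnerProductSpace ℂ (Pre 𝓔) := .ofCore _

/-- (Ported verbatim from the HodgeCMPerL package; no docstring in the source.) -/
theorem inner_pre_def (f g : Pre 𝓔) :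
    ⟪f, g⟫_ℂ = f.sum fun x a => g.sum fun y b => conj a * b * kfun x y := rfl

variable (𝓔) in
/-- **The restricted Hilbert tensor product** `⊗′_i (H i, e i)`: a complete complex inner-product
space. -/
abbrev Space : Type (max u v) := UniformSpace.Completion (Pre 𝓔)

example : CompleteSpace (Space 𝓔) := inferInstance
example : InnerProductSpace ℂ (Space 𝓔) := inferInstance

variable (𝓔) in
/-- The pure tensor `⊗_i x_i` of a restricted family. -/
def tp (x : RVec 𝓔) : Space 𝓔 := ((Finsupp.single x (1 : ℂ) : Pre 𝓔) : Space 𝓔)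

/-- (Ported verbatim from the HodgeCMPerL package; no docstring in the source.) -/
theorem coe_single (x : RVec 𝓔) (a : ℂ) :
    ((Finsupp.single x a : Pre 𝓔) : Space 𝓔) = a • tp 𝓔 x := by
  rw [tp, ← UniformSpace.Completion.coe_smul, Finsupp.smul_single_one]

/-- (Ported verbatim from the HodgeCMPerL package; no docstring in the source.) -/
theorem coe_pre_eq_sum (f : Pre 𝓔) : (f : Space 𝓔) = f.sum fun x a => a • tp 𝓔 x := by
  conv_lhs => rw [← Finsupp.sum_single f]
  rw [show ((f.sum Finsupp.single : Pre 𝓔) : Space 𝓔) =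
      UniformSpace.Completion.toCompl (f.sum Finsupp.single) from rfl, map_finsuppSum]
  exact Finsupp.sum_congr fun x _ => coe_single x _

/-- (Ported verbatim from the HodgeCMPerL package; no docstring in the source.) -/
theorem inner_tp_coe (x : RVec 𝓔) (f : Pre 𝓔) :
    ⟪tp 𝓔 x, (f : Space 𝓔)⟫_ℂ = f.sum fun y b => b * kfun x y := by
  rw [tp, UniformSpace.Completion.inner_coe, inner_pre_def, Finsupp.sum_single_index] <;> simp

/-- (Ported verbatim from the HodgeCMPerL package; no docstring in the source.) -/
@[simp] theorem inner_tp_tp (x y : RVec 𝓔) : ⟪tp 𝓔 x, tp 𝓔 y⟫_ℂ = kfun x y := by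
  show ⟪tp 𝓔 x, ((Finsupp.single y (1 : ℂ) : Pre 𝓔) : Space 𝓔)⟫_ℂ = kfun x y
  rw [inner_tp_coe, Finsupp.sum_single_index] <;> simp

/-- (Ported verbatim from the HodgeCMPerL package; no docstring in the source.) -/
theorem inner_tp_tp_eq_finprod (x y : RVec 𝓔) : ⟪tp 𝓔 x, tp 𝓔 y⟫_ℂ = ∏ᶠ i, ⟪x i, y i⟫_ℂ :=
  inner_tp_tp x y

/-- (Ported verbatim from the HodgeCMPerL package; no docstring in the source.) -/
theorem hasFiniteMulSupport_norm (x : RVec 𝓔) : HasFiniteMulSupport fun i => ‖x i‖ :=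
  x.finite_ne.subset fun i hi => by
    contrapose! hi
    simp only [Set.mem_setOf_eq, not_not] at hi
    simp [hi, 𝓔.norm_e]

/-- (Ported verbatim from the HodgeCMPerL package; no docstring in the source.) -/
theorem norm_tp_sq (x : RVec 𝓔) : ‖tp 𝓔 x‖ ^ 2 = ∏ᶠ i, ‖x i‖ ^ 2 := by
  have h1 : ⟪tp 𝓔 x, tp 𝓔 x⟫_ℂ = ((‖tp 𝓔 x‖ ^ 2 : ℝ) : ℂ) := by
    rw [inner_self_eq_norm_sq_to_K]; norm_cast
  have h2 : ∀ i, ⟪x i, x i⟫_ℂ = ((‖x i‖ ^ 2 : ℝ) : ℂ) := fun i => by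
    rw [inner_self_eq_norm_sq_to_K]; norm_cast
  have h3 : ((∏ᶠ i, ‖x i‖ ^ 2 : ℝ) : ℂ) = ∏ᶠ i, (((‖x i‖ ^ 2 : ℝ)) : ℂ) := by
    rw [show ((∏ᶠ i, ‖x i‖ ^ 2 : ℝ) : ℂ) = Complex.ofRealHom (∏ᶠ i, ‖x i‖ ^ 2) from rfl,
      map_finprod _ ((hasFiniteMulSupport_norm x).fun_comp (g := fun r : ℝ => r ^ 2) (by simp))]
    simp only [Complex.ofRealHom_eq_coe]
  rw [inner_tp_tp, kfun, finprod_congr h2, ← h3] at h1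
  exact_mod_cast h1.symm

/-- (Ported verbatim from the HodgeCMPerL package; no docstring in the source.) -/
theorem norm_tp (x : RVec 𝓔) : ‖tp 𝓔 x‖ = ∏ᶠ i, ‖x i‖ := by
  have h := norm_tp_sq x
  rw [← finprod_pow (hasFiniteMulSupport_norm x)] at h
  exact (pow_left_inj₀ (norm_nonneg _) (finprod_nonneg fun i => norm_nonneg _) two_ne_zero).mp h


/-! ### Totality of the pure tensors; extensionality -/

/-- Two vectors with the same inner products against all pure tensors are equal. -/
theorem ext_inner_tp {u u' : Space 𝓔} (h : ∀ x : RVec 𝓔, ⟪tp 𝓔 x, u⟫_ℂ = ⟪tp 𝓔 x, u'⟫_ℂ) :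
    u = u' := by
  refine UniformSpace.Completion.denseRange_coe.eq_of_inner_right ℂ fun f => ?_
  rw [coe_pre_eq_sum, Finsupp.sum, sum_inner, sum_inner]
  exact Finset.sum_congr rfl fun x _ => by rw [inner_smul_left, inner_smul_left, h]

/-- Two continuous linear maps agreeing on all pure tensors are equal. -/
theorem clm_ext {F : Type*} [TopologicalSpace F] [T2Space F] [AddCommMonoid F] [Module ℂ F]
    {A A' : Space 𝓔 →L[ℂ] F} (h : ∀ x : RVec 𝓔, A (tp 𝓔 x) = A' (tp 𝓔 x)) : A = A' := by
  refine ContinuousLinearMap.ext fun z => ?_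
  refine UniformSpace.Completion.induction_on z (isClosed_eq A.continuous A'.continuous) fun f => ?_
  rw [coe_pre_eq_sum, map_finsuppSum, map_finsuppSum]
  exact Finsupp.sum_congr fun x _ => by rw [map_smul, map_smul, h]

/-- The pure tensors span a dense subspace. -/
theorem dense_span_tp : Dense ((Submodule.span ℂ (Set.range (tp 𝓔)) : Submodule ℂ (Space 𝓔)) :
    Set (Space 𝓔)) := by
  refine UniformSpace.Completion.denseRange_coe.mono ?_
  rintro _ ⟨f, rfl⟩
  rw [coe_pre_eq_sum]
  exact Submodule.sum_mem _ fun x _ => Submodule.smul_mem _ _ (Submodule.subset_span ⟨x, rfl⟩)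

/-! ## §3 Slots: `v ↦ ⊗ (x with x_i := v)` -/

section slot

/-- The kernel with the `i`-th factor removed. -/
def kOff (i : ι) (x y : RVec 𝓔) : ℂ := ∏ᶠ (j) (_ : j ≠ i), ⟪x j, y j⟫_ℂ

/-- (Ported verbatim from the HodgeCMPerL package; no docstring in the source.) -/
theorem kfun_eq_mul_kOff (i : ι) (x y : RVec 𝓔) : kfun x y = ⟪x i, y i⟫_ℂ * kOff i x y :=
  (mul_finprod_cond_ne i (hasFiniteMulSupport_inner x y)).symm

/-- (Ported verbatim from the HodgeCMPerL package; no docstring in the source.) -/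
theorem kOff_self_of_norm_eq_one (i : ι) (x : RVec 𝓔) (hx : ∀ j, ‖x j‖ = 1) : kOff i x x = 1 :=
  finprod_eq_one_of_forall_eq_one fun j => by
    rw [show (fun _ : j ≠ i => ⟪x j, x j⟫_ℂ) = fun _ => 1 from funext fun _ => by
      rw [inner_self_eq_norm_sq_to_K, hx j]; simp]
    exact finprod_one

variable [DecidableEq ι]

/-- (Ported verbatim from the HodgeCMPerL package; no docstring in the source.) -/
theorem kOff_update_right (i : ι) (x y : RVec 𝓔) (v : H i) :
    kOff i x (y.update i v) = kOff i x y :=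
  finprod_congr fun j => finprod_congr fun hj => by rw [RVec.update_apply_of_ne _ hj]


-- port_pkg: scope closed for this part
end slot
end HodgeCM.PerL34.RestrictedTensor
end
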